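import Literature.AlgebraicGeometry.Motives.HodgeStructureNoExoticClassesProductPowers
import Literature.AlgebraicGeometry.Motives.HodgeStructureLefschetzGroupNoExoticClassesTFAE
import Literature.AlgebraicGeometry.Motives.HodgeStructureNonempty
import HarnessLib

/-!
# IN ODD WEIGHT THE CENTRAL SUBFIELD `F₀` OF A STRONG CM-HODGE STRUCTURE IS A CM FIELD — `[F₀:ℚ] ≠ 1` AUTOMATICALLY (a Hodge
# structure of odd weight has even rank, Voisin Cor. 6.13, so `V` has no one-dimensional sub-Hodge structure) — and the
# nondegeneracy criteria of gens 38–39 WITHOUT the standing hypothesis `[F₀:ℚ] ≠ 1`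

[topic AlgebraicGeometry/Motives]

Layer `Literature/AlgebraicGeometry/Motives`, lane `lit-hodgefound` (Track 2 foundations library; seat `lit-hodgefound-p02`, gen 39,
row g39-#8). THEOREMS ONLY: no definition, no named fact (D-0026 net debt `0`), no instance, no notation. Hypothesis hygiene for
the seat's gen-36…39 files: they carry `h1 : [F₀:ℚ] ≠ 1` (g36-#2 `finrank_centralSubfield_eq_one_iff`: `[F₀:ℚ] = 1` iff `V` has a
one-dimensional sub-Hodge structure — the «sum of Hodge lines» case, where `F₀ = ℚ` is not CM) next to `Odd n`; but a `ℚ`-Hodge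
structure of ODD weight has EVEN rank (the tree's `HodgeStructure.isEmpty_of_odd`, Voisin Cor. 6.13), so a Hodge LINE of odd
weight does not exist and `h1` is automatic. §1 proves this; §2 restates the odd-weight criteria of g38-#1/#2, g39-#4/#5/#6/#7
without `h1`.

## The sources, verbatim

* C. Voisin, *Hodge Theory and Complex Algebraic Geometry I* [VoisinHodgeI2002], Cor. 6.13: the odd Betti numbers of a compact Kähler
  manifold are even (`H^{2m+1} = F^{m+1} ⊕ \overline{F^{m+1}}`); the tree's `HodgeStructure.isEmpty_of_odd`: «`HodgeStructure V n` is
  EMPTY for `n` odd and `dim_ℚ V` odd».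
* M. Green, P. Griffiths, M. Kerr, *Mumford–Tate Groups and Domains* [GreenGriffithsKerr2012], §V.B «Basic facts» p. 159 (the sub-Hodge
  structures of a SCMHS), §V.C p. 162 («for an irreducible, polarizable, CMHS `(V, φ)` of any weight … `E_φ` is a CM-field»), §V.D
  p. 164, (V.D.5), (V.D.6) p. 165.
* B. B. Gordon, *A survey of the Hodge conjecture for abelian varieties* [Gordon1999HodgeAVSurvey]: Def. 2.13, Thm. 6.4 (Hazama),
  Thm. 7.5, Remarks 7.6.1; J. S. Milne, *Lefschetz classes on abelian varieties* [Milne1999LefschetzClasses], §4 Prop. 4.8 (p. 660).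

## What is PROVED (`A : EndAction H E` a strong CM structure, `hS : [F:ℚ] = dim V`, weight `n` ODD)

* §1 **`EndAction.finrank_centralSubfield_ne_one_of_odd`** (`[F₀:ℚ] ≠ 1`), `EndAction.two_le_finrank_centralSubfield_of_odd`,
  **`EndAction.isCMField_centralSubfield_of_odd`** (polarizable ⟹ `F₀` is a CM field), `EndAction.even_finrank_centralSubfield_of_odd`.
* §2 (polarized by `ψ`, auxiliary `(L, j, ι)`; all `h1`-free): `…_iff_hodgeGroupBaseChange_eq_lefschetzGroupBaseChange_of_odd`,
  `…_iff_lefschetzGroupBaseChange_le_hodgeGroupBaseChange_of_odd`, `…_iff_two_mul_finrank_hodgeLie_eq_of_odd`,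
  `…_iff_forall_divisorClasses_pi_eq_of_odd`, `…_iff_forall_fintype_divisorClasses_pi_eq_of_odd`, `exists_exotic_of_not_isNondegenerate_of_odd`,
  `not_isNondegenerate_orientation_iff_exists_exotic_of_odd`, `forall_divisorClasses_pi_eq_iff_two_mul_finrank_hodgeLie_eq_of_odd`,
  `isStronglyNondegenerate_orientation_iff_isIrreducible_and_forall_divisorClasses_pi_eq_of_odd`, **`isNondegenerate_orientation_tfae_of_odd`**
  (nine forms), **`not_isNondegenerate_orientation_tfae_of_odd`** (six forms); heredity: `isNondegenerate_orientation_of_comp_eq_id_of_odd`,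
  `…_iff_of_bijective_of_odd`, `…_pi_iff_of_odd`, `…_of_prod_of_odd`, `…_prodPow_iff_of_odd`. (Weight one: apply with `odd_one`.)

## References

* [VoisinHodgeI2002] C. Voisin, *Hodge Theory and Complex Algebraic Geometry I*, CUP (2002): Cor. 6.13.
* [GreenGriffithsKerr2012] M. Green, P. Griffiths, M. Kerr, *Mumford–Tate Groups and Domains* (2012): §V.B p. 159, §V.C p. 162, §V.D pp. 164–165.
* [Gordon1999HodgeAVSurvey] B. B. Gordon, *A survey of the Hodge conjecture for abelian varieties*, CRM Monogr. 10 (1999): Def. 2.13, Thm. 6.4,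
  Thm. 7.5, Remarks 7.6.1.
* [Milne1999LefschetzClasses] J. S. Milne, *Lefschetz classes on abelian varieties*, Duke Math. J. 96 (1999): §4 Prop. 4.8 (p. 660).
-/

noncomputable section

open Module NumberField

namespace Literature.AlgebraicGeometry.Motives

namespace HodgeStructure

namespace EndAction

/-! ## §1 Odd weight: `[F₀:ℚ] ≠ 1`, and `F₀` is a CM field -/

section Central

variable {V : Type} [AddCommGroup V] [Module ℚ V] [Module.Finite ℚ V] {n : ℤ} {H : HodgeStructure V n}
  {E : Type} [Field E] [NumberField E] (A : EndAction H E) [HodgeTensorFacts.{0, 0}]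

/-- **In ODD weight `[F₀:ℚ] ≠ 1`**: `[F₀:ℚ] = 1` would give a one-dimensional sub-Hodge structure of `V` (g36-#2
`finrank_centralSubfield_eq_one_iff`), i.e. a `ℚ`-Hodge structure of odd weight on a line — impossible, odd weight forces even rank
(`HodgeStructure.isEmpty_of_odd`). [cite: VoisinHodgeI2002, Cor. 6.13] [cite: GreenGriffithsKerr2012, §V.B «Basic facts» p. 159] -/
theorem finrank_centralSubfield_ne_one_of_odd (hS : finrank ℚ E = finrank ℚ V) (hn : Odd n) :
    finrank ℚ A.centralSubfield ≠ 1 := fun h1 => by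
  obtain ⟨S, hS1⟩ := (A.finrank_centralSubfield_eq_one_iff hS).1 h1
  exact (HodgeStructure.isEmpty_of_odd hn (by rw [hS1]; exact odd_one)).false S.toHodgeStructure

/-- **In odd weight `[F₀:ℚ] ≥ 2`.** [cite: VoisinHodgeI2002, Cor. 6.13] [cite: GreenGriffithsKerr2012, §V.B p. 159] -/
theorem two_le_finrank_centralSubfield_of_odd (hS : finrank ℚ E = finrank ℚ V) (hn : Odd n) :
    2 ≤ finrank ℚ A.centralSubfield := by
  have h1 := A.finrank_centralSubfield_ne_one_of_odd hS hn
  have h0 : 0 < finrank ℚ A.centralSubfield := finrank_pos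
  omega

/-- **In ODD weight the central subfield `F₀` of a POLARIZABLE strong CM-Hodge structure is a CM FIELD** (g36-#2
`isCMField_centralSubfield` with `[F₀:ℚ] ≠ 1` automatic). [cite: GreenGriffithsKerr2012, §V.C p. 162 («E_φ is a CM-field») and §V.B p. 159]
[cite: VoisinHodgeI2002, Cor. 6.13] -/
theorem isCMField_centralSubfield_of_odd (hS : finrank ℚ E = finrank ℚ V) (hH : H.IsPolarizable) (hn : Odd n) :
    IsCMField A.centralSubfield :=
  A.isCMField_centralSubfield hS hH (A.finrank_centralSubfield_ne_one_of_odd hS hn)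

/-- **In odd weight `[F₀:ℚ]` is even** (polarizable). [cite: GreenGriffithsKerr2012, §V.C p. 162 and §V.D p. 164] [cite: VoisinHodgeI2002, Cor. 6.13] -/
theorem even_finrank_centralSubfield_of_odd (hS : finrank ℚ E = finrank ℚ V) (hH : H.IsPolarizable) (hn : Odd n) :
    Even (finrank ℚ A.centralSubfield) :=
  A.even_finrank_centralSubfield hS hH (A.finrank_centralSubfield_ne_one_of_odd hS hn)

end Central

/-! ## §2 The odd-weight nondegeneracy criteria without the hypothesis `[F₀:ℚ] ≠ 1` -/

section Criteria

variable {V : Type} [AddCommGroup V] [Module ℚ V] [Module.Finite ℚ V] {n : ℤ} {H : HodgeStructure V n}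
  {E : Type} [Field E] [NumberField E] (A : EndAction H E) [HodgeTensorFacts.{0, 0}]
  {L : Type} [Field L] [NumberField L] [IsGalois ℚ L]

omit [HodgeTensorFacts.{0, 0}] in
/-- An odd integer is non-zero. [folklore] -/
private theorem ne_zero_of_odd_g39h {m : ℤ} (hm : Odd m) : m ≠ 0 := by
  rintro rfl
  exact (by decide : ¬Odd (0 : ℤ)) hm

/-- **ODD weight: `(F, Π_φ)` nondegenerate ⟺ `Hg(V)(ℂ) = S(H)(ℂ)`** (g38-#2 without `[F₀:ℚ] ≠ 1`). [cite: GreenGriffithsKerr2012, (V.D.6) p. 165]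
[cite: Milne1999LefschetzClasses, §4 Prop. 4.8 (c) (p. 660)] -/
theorem isNondegenerate_orientation_iff_hodgeGroupBaseChange_eq_lefschetzGroupBaseChange_of_odd (ψ : Polarization H)
    (hS : finrank ℚ E = finrank ℚ V) (hn : Odd n) (j : E →ₐ[ℚ] L) (ι : L →+* ℂ) :
    (A.orientation hS).IsNondegenerate j ι ↔ H.hodgeGroupBaseChange ℂ = ψ.lefschetzGroupBaseChange ℂ :=
  A.isNondegenerate_orientation_iff_hodgeGroupBaseChange_eq_lefschetzGroupBaseChange ψ hS (ne_zero_of_odd_g39h hn)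
    (A.finrank_centralSubfield_ne_one_of_odd hS hn) j ι

/-- **ODD weight: nondegenerate ⟺ `S(H)(ℂ) ≤ Hg(V)(ℂ)`.** [cite: GreenGriffithsKerr2012, (V.D.6) p. 165] [cite: Milne1999LefschetzClasses, §4 p. 660 («L(A) ⊃ Hg(A)»)] -/
theorem isNondegenerate_orientation_iff_lefschetzGroupBaseChange_le_hodgeGroupBaseChange_of_odd (ψ : Polarization H)
    (hS : finrank ℚ E = finrank ℚ V) (hn : Odd n) (j : E →ₐ[ℚ] L) (ι : L →+* ℂ) :
    (A.orientation hS).IsNondegenerate j ι ↔ ψ.lefschetzGroupBaseChange ℂ ≤ H.hodgeGroupBaseChange ℂ :=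
  A.isNondegenerate_orientation_iff_lefschetzGroupBaseChange_le_hodgeGroupBaseChange ψ hS (ne_zero_of_odd_g39h hn)
    (A.finrank_centralSubfield_ne_one_of_odd hS hn) j ι

/-- **ODD weight: nondegenerate ⟺ `2·dim Hg(V) = [F₀:ℚ]`** (g38-#1 without `[F₀:ℚ] ≠ 1`; Gordon 2.13 «`dim Hg(A) = dim A`»).
[cite: GreenGriffithsKerr2012, §V.D p. 164 and (V.D.5)] [cite: Gordon1999HodgeAVSurvey, Def. 2.13] -/
theorem isNondegenerate_orientation_iff_two_mul_finrank_hodgeLie_eq_of_odd (ψ : Polarization H)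
    (hS : finrank ℚ E = finrank ℚ V) (hn : Odd n) (j : E →ₐ[ℚ] L) (ι : L →+* ℂ) :
    (A.orientation hS).IsNondegenerate j ι ↔ 2 * finrank ℚ H.hodgeLie = finrank ℚ A.centralSubfield :=
  A.isNondegenerate_orientation_iff_two_mul_finrank_hodgeLie_eq hS ψ (ne_zero_of_odd_g39h hn)
    (A.finrank_centralSubfield_ne_one_of_odd hS hn) j ι

/-- **ODD weight: nondegenerate ⟺ no power `V^{⊕m}` supports an exotic Hodge class** (g39-#4 without `[F₀:ℚ] ≠ 1`; Hazama 6.4,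
Gordon 7.5 (1)). [cite: Gordon1999HodgeAVSurvey, Thm. 6.4 (Hazama) and Thm. 7.5] [cite: Milne1999LefschetzClasses, §4 Prop. 4.8 (p. 660)] -/
theorem isNondegenerate_orientation_iff_forall_divisorClasses_pi_eq_of_odd (ψ : Polarization H)
    (hS : finrank ℚ E = finrank ℚ V) (hn : Odd n) (j : E →ₐ[ℚ] L) (ι : L →+* ℂ) :
    (A.orientation hS).IsNondegenerate j ι ↔
      ∀ (m : ℕ), 0 < m → ∀ p : ℕ, (HodgeStructure.pi fun _ : Fin m => H).divisorClasses p =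
        ((HodgeStructure.pi fun _ : Fin m => H).exteriorPower (2 * p)).hodgeClasses (p * n) :=
  A.isNondegenerate_orientation_iff_forall_divisorClasses_pi_eq ψ hS hn (A.finrank_centralSubfield_ne_one_of_odd hS hn) j ι

/-- **ODD weight: nondegenerate ⟺ no power `V^{⊕κ}` (any finite non-empty `κ`) supports an exotic Hodge class.**
[cite: Gordon1999HodgeAVSurvey, Thm. 6.4 (Hazama), Thm. 7.5 and Def. 7.6] [cite: Milne1999LefschetzClasses, §4 Prop. 4.8 (p. 660)] -/
theorem isNondegenerate_orientation_iff_forall_fintype_divisorClasses_pi_eq_of_odd (ψ : Polarization H)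
    (hS : finrank ℚ E = finrank ℚ V) (hn : Odd n) (j : E →ₐ[ℚ] L) (ι : L →+* ℂ) :
    (A.orientation hS).IsNondegenerate j ι ↔
      ∀ (κ : Type) [Fintype κ] [DecidableEq κ] [Nonempty κ] (p : ℕ), (HodgeStructure.pi fun _ : κ => H).divisorClasses p =
        ((HodgeStructure.pi fun _ : κ => H).exteriorPower (2 * p)).hodgeClasses (p * n) :=
  A.isNondegenerate_orientation_iff_forall_fintype_divisorClasses_pi_eq ψ hS hn (A.finrank_centralSubfield_ne_one_of_odd hS hn) j ι

/-- **ODD weight: DEGENERATE ⟹ an exotic Hodge class on some power** (g39-#4 without `[F₀:ℚ] ≠ 1`). [cite: Murty1984, §3]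
[cite: Gordon1999HodgeAVSurvey, Thm. 7.5] [cite: Milne1999LefschetzClasses, §4 Prop. 4.8 (p. 660)] -/
theorem exists_exotic_of_not_isNondegenerate_of_odd (ψ : Polarization H) (hS : finrank ℚ E = finrank ℚ V) (hn : Odd n)
    (j : E →ₐ[ℚ] L) (ι : L →+* ℂ) (hdeg : ¬(A.orientation hS).IsNondegenerate j ι) :
    ∃ (m : ℕ), 0 < m ∧ ∃ (p : ℕ), ∃ x ∈ ((HodgeStructure.pi fun _ : Fin m => H).exteriorPower (2 * p)).hodgeClasses (p * n),
      x ∉ (HodgeStructure.pi fun _ : Fin m => H).divisorClasses p :=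
  A.exists_exotic_of_not_isNondegenerate ψ hS hn (A.finrank_centralSubfield_ne_one_of_odd hS hn) j ι hdeg

/-- **ODD weight: degenerate ⟺ an exotic Hodge class on some power.** [cite: Murty1984, §3] [cite: Gordon1999HodgeAVSurvey, Thm. 7.5 and Def. 7.6]
[cite: Milne1999LefschetzClasses, §4 Prop. 4.8 (p. 660)] -/
theorem not_isNondegenerate_orientation_iff_exists_exotic_of_odd (ψ : Polarization H) (hS : finrank ℚ E = finrank ℚ V)
    (hn : Odd n) (j : E →ₐ[ℚ] L) (ι : L →+* ℂ) :
    ¬(A.orientation hS).IsNondegenerate j ι ↔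
      ∃ (m : ℕ), 0 < m ∧ ∃ (p : ℕ), ∃ x ∈ ((HodgeStructure.pi fun _ : Fin m => H).exteriorPower (2 * p)).hodgeClasses (p * n),
        x ∉ (HodgeStructure.pi fun _ : Fin m => H).divisorClasses p :=
  A.not_isNondegenerate_orientation_iff_exists_exotic ψ hS hn (A.finrank_centralSubfield_ne_one_of_odd hS hn) j ι

/-- **ODD weight: no power supports an exotic Hodge class ⟺ `2·dim Hg(V) = [F₀:ℚ]`** (Gordon 7.5 (1) ⟺ (3), Hazama 6.4).
[cite: Gordon1999HodgeAVSurvey, Thm. 6.4 (Hazama) and Thm. 7.5 (1) ⟺ (3)] [cite: GreenGriffithsKerr2012, (V.D.5) p. 164] -/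
theorem forall_divisorClasses_pi_eq_iff_two_mul_finrank_hodgeLie_eq_of_odd (ψ : Polarization H)
    (hS : finrank ℚ E = finrank ℚ V) (hn : Odd n) (j : E →ₐ[ℚ] L) (ι : L →+* ℂ) :
    (∀ (m : ℕ), 0 < m → ∀ p : ℕ, (HodgeStructure.pi fun _ : Fin m => H).divisorClasses p =
        ((HodgeStructure.pi fun _ : Fin m => H).exteriorPower (2 * p)).hodgeClasses (p * n)) ↔
      2 * finrank ℚ H.hodgeLie = finrank ℚ A.centralSubfield :=
  A.forall_divisorClasses_pi_eq_iff_two_mul_finrank_hodgeLie_eq ψ hS hn (A.finrank_centralSubfield_ne_one_of_odd hS hn) j ι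

/-- **ODD weight: strongly nondegenerate ⟺ irreducible and no power supports an exotic Hodge class.**
[cite: Gordon1999HodgeAVSurvey, Thm. 6.1 (Tankeev), Thm. 6.4 (Hazama) and Def. 2.13] [cite: GreenGriffithsKerr2012, (V.A.7) p. 157 and §V.D p. 164] -/
theorem isStronglyNondegenerate_orientation_iff_isIrreducible_and_forall_divisorClasses_pi_eq_of_odd (ψ : Polarization H)
    (hS : finrank ℚ E = finrank ℚ V) (hn : Odd n) (j : E →ₐ[ℚ] L) (ι : L →+* ℂ) :
    (A.orientation hS).IsStronglyNondegenerate j ι ↔ H.IsIrreducible ∧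
      ∀ (m : ℕ), 0 < m → ∀ p : ℕ, (HodgeStructure.pi fun _ : Fin m => H).divisorClasses p =
        ((HodgeStructure.pi fun _ : Fin m => H).exteriorPower (2 * p)).hodgeClasses (p * n) :=
  A.isStronglyNondegenerate_orientation_iff_isIrreducible_and_forall_divisorClasses_pi_eq ψ hS hn
    (A.finrank_centralSubfield_ne_one_of_odd hS hn) j ι

/-- **THE NONDEGENERACY `TFAE` IN ODD WEIGHT, without `[F₀:ℚ] ≠ 1`** (nine forms, g39-#6). [cite: GreenGriffithsKerr2012, §V.D p. 164, (V.D.5) and (V.D.6) p. 165]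
[cite: Gordon1999HodgeAVSurvey, Def. 2.13, Thm. 6.4 (Hazama) and Thm. 7.5] [cite: Milne1999LefschetzClasses, §4 Prop. 4.8 (p. 660)] -/
theorem isNondegenerate_orientation_tfae_of_odd (ψ : Polarization H) (hS : finrank ℚ E = finrank ℚ V) (hn : Odd n)
    (j : E →ₐ[ℚ] L) (ι : L →+* ℂ) :
    List.TFAE
      [ (A.orientation hS).IsNondegenerate j ι,
        H.mtRank = finrank ℚ A.centralSubfield / 2 + 1,
        2 * finrank ℚ H.hodgeLie = finrank ℚ A.centralSubfield,
        H.hodgeGroupBaseChange ℂ = ψ.lefschetzGroupBaseChange ℂ,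
        H.mumfordTateGroupBaseChange ℂ = ψ.lefschetzSimilitudeGroupBaseChange ℂ,
        ∀ (m : ℕ), 0 < m → ∀ p : ℕ, (HodgeStructure.pi fun _ : Fin m => H).divisorClasses p =
          ((HodgeStructure.pi fun _ : Fin m => H).exteriorPower (2 * p)).hodgeClasses (p * n),
        ∀ (κ : Type) [Fintype κ] [DecidableEq κ] [Nonempty κ] (p : ℕ), (HodgeStructure.pi fun _ : κ => H).divisorClasses p =
          ((HodgeStructure.pi fun _ : κ => H).exteriorPower (2 * p)).hodgeClasses (p * n),
        ψ.lefschetzGroupBaseChange ℂ ≤ H.hodgeGroupBaseChange ℂ,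
        ψ.lefschetzSimilitudeGroupBaseChange ℂ ≤ H.mumfordTateGroupBaseChange ℂ ] :=
  A.isNondegenerate_orientation_tfae ψ hS hn (A.finrank_centralSubfield_ne_one_of_odd hS hn) j ι

/-- **THE DEGENERATE `TFAE` IN ODD WEIGHT, without `[F₀:ℚ] ≠ 1`** (six forms, g39-#6). [cite: GreenGriffithsKerr2012, §V.D p. 164 and (V.D.6) p. 165]
[cite: Gordon1999HodgeAVSurvey, Thm. 6.4 (Hazama) and Thm. 7.5] [cite: Murty1984, §3] -/
theorem not_isNondegenerate_orientation_tfae_of_odd (ψ : Polarization H) (hS : finrank ℚ E = finrank ℚ V) (hn : Odd n)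
    (j : E →ₐ[ℚ] L) (ι : L →+* ℂ) :
    List.TFAE
      [ ¬(A.orientation hS).IsNondegenerate j ι,
        H.hodgeGroupBaseChange ℂ < ψ.lefschetzGroupBaseChange ℂ,
        H.mumfordTateGroupBaseChange ℂ < ψ.lefschetzSimilitudeGroupBaseChange ℂ,
        ∃ (m : ℕ), 0 < m ∧ ∃ (p : ℕ), ∃ x ∈ ((HodgeStructure.pi fun _ : Fin m => H).exteriorPower (2 * p)).hodgeClasses (p * n),
          x ∉ (HodgeStructure.pi fun _ : Fin m => H).divisorClasses p,
        2 * finrank ℚ H.hodgeLie < finrank ℚ A.centralSubfield,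
        H.mtRank < finrank ℚ A.centralSubfield / 2 + 1 ] :=
  A.not_isNondegenerate_orientation_tfae ψ hS hn (A.finrank_centralSubfield_ne_one_of_odd hS hn) j ι

end Criteria

/-! ### Heredity (g39-#5, g39-#7) without `[F₀:ℚ] ≠ 1` -/

section Heredity

variable {V W : Type} [AddCommGroup V] [Module ℚ V] [Module.Finite ℚ V] [AddCommGroup W] [Module ℚ W] [Module.Finite ℚ W]
  {n : ℤ} {H₁ : HodgeStructure V n} {H₂ : HodgeStructure W n} {H : HodgeStructure V n}
  {E₁ E₂ E E' : Type} [Field E₁] [NumberField E₁] [Field E₂] [NumberField E₂] [Field E] [NumberField E] [Field E'] [NumberField E']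
  [HodgeTensorFacts.{0, 0}]
  {L₁ L₂ L L' : Type} [Field L₁] [NumberField L₁] [IsGalois ℚ L₁] [Field L₂] [NumberField L₂] [IsGalois ℚ L₂]
  [Field L] [NumberField L] [IsGalois ℚ L] [Field L'] [NumberField L'] [IsGalois ℚ L']

/-- **ODD weight: a retract of a nondegenerate strong CM-Hodge structure is nondegenerate** (for every strong CM structure on it;
g39-#5 without `[F₀:ℚ] ≠ 1`). [cite: Gordon1999HodgeAVSurvey, Remarks 7.6.1 (Hazama), first bullet, and Thm. 6.4] [cite: GreenGriffithsKerr2012, (V.D.6) p. 165] -/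
theorem isNondegenerate_orientation_of_comp_eq_id_of_odd (A₁ : EndAction H₁ E₁) (A₂ : EndAction H₂ E₂)
    (ψ₁ : Polarization H₁) (ψ₂ : Polarization H₂) (hS₁ : finrank ℚ E₁ = finrank ℚ V) (hS₂ : finrank ℚ E₂ = finrank ℚ W)
    (hn : Odd n) (j₁ : E₁ →ₐ[ℚ] L₁) (ι₁ : L₁ →+* ℂ) (j₂ : E₂ →ₐ[ℚ] L₂) (ι₂ : L₂ →+* ℂ)
    (f : Hom H₁ H₂) (s : Hom H₂ H₁) (hfs : f.comp s = Hom.id H₂) (hnd : (A₁.orientation hS₁).IsNondegenerate j₁ ι₁) :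
    (A₂.orientation hS₂).IsNondegenerate j₂ ι₂ :=
  A₁.isNondegenerate_orientation_of_comp_eq_id A₂ ψ₁ ψ₂ hS₁ hS₂ hn (A₁.finrank_centralSubfield_ne_one_of_odd hS₁ hn)
    (A₂.finrank_centralSubfield_ne_one_of_odd hS₂ hn) j₁ ι₁ j₂ ι₂ f s hfs hnd

/-- **ODD weight: nondegeneracy is invariant under isomorphisms of the underlying `ℚ`-Hodge structures.**
[cite: Gordon1999HodgeAVSurvey, Remarks 7.6.1 (Hazama) and Thm. 6.4] [cite: GreenGriffithsKerr2012, (V.D.6) p. 165] -/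
theorem isNondegenerate_orientation_iff_of_bijective_of_odd (A₁ : EndAction H₁ E₁) (A₂ : EndAction H₂ E₂)
    (ψ₁ : Polarization H₁) (ψ₂ : Polarization H₂) (hS₁ : finrank ℚ E₁ = finrank ℚ V) (hS₂ : finrank ℚ E₂ = finrank ℚ W)
    (hn : Odd n) (j₁ : E₁ →ₐ[ℚ] L₁) (ι₁ : L₁ →+* ℂ) (j₂ : E₂ →ₐ[ℚ] L₂) (ι₂ : L₂ →+* ℂ)
    (f : Hom H₁ H₂) (hf : Function.Bijective f.toLinearMap) :
    (A₁.orientation hS₁).IsNondegenerate j₁ ι₁ ↔ (A₂.orientation hS₂).IsNondegenerate j₂ ι₂ :=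
  A₁.isNondegenerate_orientation_iff_of_bijective A₂ ψ₁ ψ₂ hS₁ hS₂ hn (A₁.finrank_centralSubfield_ne_one_of_odd hS₁ hn)
    (A₂.finrank_centralSubfield_ne_one_of_odd hS₂ hn) j₁ ι₁ j₂ ι₂ f hf

/-- **ODD weight: a strong CM structure on `V^{⊕κ}` is nondegenerate iff `(V, φ, F, η)` is.**
[cite: Gordon1999HodgeAVSurvey, Remarks 7.6.1 (Hazama), second bullet, and Thm. 6.4] [cite: GreenGriffithsKerr2012, (V.D.6) p. 165] -/
theorem isNondegenerate_orientation_pi_iff_of_odd {κ : Type} [Fintype κ] [DecidableEq κ] [Nonempty κ] (A : EndAction H E)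
    (A' : EndAction (HodgeStructure.pi fun _ : κ => H) E') (ψ : Polarization H)
    (ψ' : Polarization (HodgeStructure.pi fun _ : κ => H)) (hS : finrank ℚ E = finrank ℚ V)
    (hS' : finrank ℚ E' = finrank ℚ (κ → V)) (hn : Odd n) (j : E →ₐ[ℚ] L) (ι : L →+* ℂ) (j' : E' →ₐ[ℚ] L') (ι' : L' →+* ℂ) :
    (A'.orientation hS').IsNondegenerate j' ι' ↔ (A.orientation hS).IsNondegenerate j ι :=
  A.isNondegenerate_orientation_pi_iff A' ψ ψ' hS hS' hn (A.finrank_centralSubfield_ne_one_of_odd hS hn)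
    (A'.finrank_centralSubfield_ne_one_of_odd hS' hn) j ι j' ι'

/-- **ODD weight: the factors of a nondegenerate strong CM-Hodge structure on `H₁ ⊕ H₂` are nondegenerate.**
[cite: Gordon1999HodgeAVSurvey, Remarks 7.6.1 (Hazama), first bullet, and Thm. 6.4] [cite: GreenGriffithsKerr2012, (V.D.6) p. 165] -/
theorem isNondegenerate_orientation_of_prod_of_odd (A : EndAction (H₁.prod H₂) E) (A₁ : EndAction H₁ E₁) (A₂ : EndAction H₂ E₂)
    (ψ : Polarization (H₁.prod H₂)) (ψ₁ : Polarization H₁) (ψ₂ : Polarization H₂) (hS : finrank ℚ E = finrank ℚ (V × W))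
    (hS₁ : finrank ℚ E₁ = finrank ℚ V) (hS₂ : finrank ℚ E₂ = finrank ℚ W) (hn : Odd n) (j : E →ₐ[ℚ] L) (ι : L →+* ℂ)
    (j₁ : E₁ →ₐ[ℚ] L₁) (ι₁ : L₁ →+* ℂ) (j₂ : E₂ →ₐ[ℚ] L₂) (ι₂ : L₂ →+* ℂ) (hnd : (A.orientation hS).IsNondegenerate j ι) :
    (A₁.orientation hS₁).IsNondegenerate j₁ ι₁ ∧ (A₂.orientation hS₂).IsNondegenerate j₂ ι₂ :=
  A.isNondegenerate_orientation_of_prod A₁ A₂ ψ ψ₁ ψ₂ hS hS₁ hS₂ hn (A.finrank_centralSubfield_ne_one_of_odd hS hn)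
    (A₁.finrank_centralSubfield_ne_one_of_odd hS₁ hn) (A₂.finrank_centralSubfield_ne_one_of_odd hS₂ hn) j ι j₁ ι₁ j₂ ι₂ hnd

/-- **ODD weight: a strong CM structure on `V₁^{⊕κ₁} ⊕ V₂^{⊕κ₂}` is nondegenerate iff one on `V₁ ⊕ V₂` is** (Hazama (iii)).
[cite: Gordon1999HodgeAVSurvey, Remarks 7.6.1 (iii) (Hazama) and Thm. 6.4] [cite: GreenGriffithsKerr2012, (V.D.6) p. 165] -/
theorem isNondegenerate_orientation_prodPow_iff_of_odd {κ₁ κ₂ : Type} [Fintype κ₁] [DecidableEq κ₁] [Fintype κ₂]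
    [DecidableEq κ₂] [Nonempty κ₁] [Nonempty κ₂]
    (A : EndAction ((HodgeStructure.pi fun _ : κ₁ => H₁).prod (HodgeStructure.pi fun _ : κ₂ => H₂)) E)
    (A' : EndAction (H₁.prod H₂) E')
    (ψ : Polarization ((HodgeStructure.pi fun _ : κ₁ => H₁).prod (HodgeStructure.pi fun _ : κ₂ => H₂)))
    (ψ' : Polarization (H₁.prod H₂)) (hS : finrank ℚ E = finrank ℚ ((κ₁ → V) × (κ₂ → W)))
    (hS' : finrank ℚ E' = finrank ℚ (V × W)) (hn : Odd n) (j : E →ₐ[ℚ] L) (ι : L →+* ℂ) (j' : E' →ₐ[ℚ] L')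
    (ι' : L' →+* ℂ) :
    (A.orientation hS).IsNondegenerate j ι ↔ (A'.orientation hS').IsNondegenerate j' ι' :=
  A.isNondegenerate_orientation_prodPow_iff A' ψ ψ' hS hS' hn (A.finrank_centralSubfield_ne_one_of_odd hS hn)
    (A'.finrank_centralSubfield_ne_one_of_odd hS' hn) j ι j' ι'

end Heredity

end EndAction

end HodgeStructure

end Literature.AlgebraicGeometry.Motives

end
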